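import Summits.Ventures.HodgeRepro2.T5SU11LegendreHeine
import Summits.Ventures.HodgeRepro2.T5SU11LegendreShiftedBridge
import Mathlib.Analysis.SpecialFunctions.Trigonometric.Chebyshev.Basic

/-!
# The Chebyshev expansion of the Legendre polynomials: `P_n = Σ_{k ≤ n} a_k a_{n−k} T_{2k−n}`, Heine's formula on the
circle `P_n(cos θ) = Σ_{k ≤ n} a_k a_{n−k} cos((2k − n)θ)`, and `|P_n| ≤ 1` on `[−1, 1]` a second time

Heine's expansion `P_n(cosh 2t) = Σ_k a_k a_{n−k} e^{(4k−2n)t}` (`T5SU11LegendreHeine`, `a_k = C(2k,k)/4^k`) at `t` and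
at `−t` averages to **`P_n(cosh 2t) = Σ_k a_k a_{n−k} cosh((2k − n) · 2t)`** (`legP_cosh_eq_sum_cosh`). Mathlib's
Chebyshev polynomials satisfy `T_m(cosh θ) = cosh(mθ)` (`Polynomial.Chebyshev.T_real_cosh`), so the polynomials
`legPoly n` and `Σ_k a_k a_{n−k} T_{2k−n}` agree on `[1, ∞)`, hence everywhere:

  **`legPoly n = Σ_{k ≤ n} a_k a_{n−k} · T_{2k−n}`**   (`legPoly_eq_chebSum`),

the classical expansion of the Legendre polynomials in Chebyshev polynomials, with the NON-NEGATIVE coefficients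
`a_k a_{n−k}` summing to `1` (`T5SU11LegendreHeine.sum_range_binomHalf`). Evaluating at `cos θ`
(`Polynomial.Chebyshev.T_real_cos`) gives **Heine's formula on the circle**

  **`P_n(cos θ) = Σ_{k ≤ n} a_k a_{n−k} cos((2k − n)θ)`**   (`legP_cos_eq_sum`)

— `P_n(cos θ)` is a cosine polynomial with non-negative coefficients of total mass `1`, whence at once
**`|P_n(cos θ)| ≤ 1`** (`abs_legP_cos_le_one`) and **`|P_n(x)| ≤ 1` on `[−1, 1]`** (`abs_legP_le_one'`): a second proof
of `T5SU11LegendreBound.abs_legP_le_one`, this time by the group's expansion (cosh ↦ cos) rather than by Sturm's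
function. Nothing is claimed about (N).

Blind lane: Mathlib + the HodgeRepro2 prefix only; no sorry; axioms ⊆ {propext, Classical.choice,
Quot.sound}.
-/

namespace Summit.Ventures.HodgeRepro2.T5SU11LegendreChebyshev

open MeasureTheory Metric Set Filter Topology Finset Polynomial
open T5SU11SphericalLegendreAll T5SU11SphericalLegendreLaplace T5SU11JacobiPhaseLawEven T5SU11LegendreHeine
  T5SU11LegendreShiftedBridge

/-! ### Heine's expansion symmetrised -/

/-- **`P_n(cosh 2t) = Σ_{k ≤ n} a_k a_{n−k} cosh((2k − n) · 2t)`** (Heine at `t` and at `−t`, averaged). -/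
theorem legP_cosh_eq_sum_cosh (n : ℕ) (t : ℝ) :
    legP n (Real.cosh (2 * t))
      = ∑ k ∈ range (n + 1), binomHalf k * binomHalf (n - k) * Real.cosh (((2 * (k : ℤ) - n : ℤ) : ℝ) * (2 * t)) := by
  have h1 := legP_cosh_eq_sum_exp n t
  have h2 := legP_cosh_eq_sum_exp n (-t)
  rw [show 2 * (-t) = -(2 * t) by ring, Real.cosh_neg] at h2
  have : legP n (Real.cosh (2 * t)) = (legP n (Real.cosh (2 * t)) + legP n (Real.cosh (2 * t))) / 2 := by ring
  rw [this]
  nth_rewrite 1 [h1]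
  rw [h2, ← Finset.sum_add_distrib, Finset.sum_div]
  refine Finset.sum_congr rfl fun k _ => ?_
  rw [Real.cosh_eq]
  push_cast
  rw [show (2 * (k : ℝ) - n) * (2 * t) = (4 * (k : ℝ) - 2 * n) * t by ring,
    show -((4 * (k : ℝ) - 2 * n) * t) = (4 * (k : ℝ) - 2 * n) * -t by ring]
  ring

/-! ### The Chebyshev expansion -/

/-- **`Σ_{k ≤ n} a_k a_{n−k} T_{2k−n}`**, the Chebyshev expansion of `P_n`. -/
noncomputable def chebSum (n : ℕ) : ℝ[X] :=
  ∑ k ∈ range (n + 1), C (binomHalf k * binomHalf (n - k)) * Chebyshev.T ℝ (2 * (k : ℤ) - n)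

/-- `(chebSum n).eval x = Σ_k a_k a_{n−k} (T_{2k−n}).eval x`. -/
theorem chebSum_eval (n : ℕ) (x : ℝ) :
    (chebSum n).eval x = ∑ k ∈ range (n + 1), binomHalf k * binomHalf (n - k) * (Chebyshev.T ℝ (2 * (k : ℤ) - n)).eval x := by
  simp only [chebSum, eval_finsetSum, eval_mul, eval_C]

/-- `(chebSum n).eval (cosh 2t) = P_n(cosh 2t)`. -/
theorem chebSum_eval_cosh (n : ℕ) (t : ℝ) : (chebSum n).eval (Real.cosh (2 * t)) = legP n (Real.cosh (2 * t)) := by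
  rw [chebSum_eval, legP_cosh_eq_sum_cosh]
  refine Finset.sum_congr rfl fun k _ => ?_
  rw [Chebyshev.T_real_cosh]

/-- **`legPoly n = Σ_{k ≤ n} a_k a_{n−k} T_{2k−n}`**: the Legendre polynomials in the Chebyshev basis. -/
theorem legPoly_eq_chebSum (n : ℕ) : legPoly n = chebSum n := by
  refine Polynomial.eq_of_infinite_eval_eq _ _ ((Set.Ici_infinite (1 : ℝ)).mono fun x hx => ?_)
  show (legPoly n).eval x = (chebSum n).eval x
  obtain ⟨t, -, ht⟩ := exists_cosh_two_mul_eq (mem_Ici.mp hx)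
  rw [← legP_eq_eval, ← ht, chebSum_eval_cosh]

/-- **`P_n(x) = Σ_{k ≤ n} a_k a_{n−k} (T_{2k−n})(x)`** for every real `x`. -/
theorem legP_eq_sum_chebyshev (n : ℕ) (x : ℝ) :
    legP n x = ∑ k ∈ range (n + 1), binomHalf k * binomHalf (n - k) * (Chebyshev.T ℝ (2 * (k : ℤ) - n)).eval x := by
  rw [legP_eq_eval, legPoly_eq_chebSum, chebSum_eval]

/-! ### Heine's formula on the circle and `|P_n| ≤ 1` -/

/-- **`P_n(cos θ) = Σ_{k ≤ n} a_k a_{n−k} cos((2k − n)θ)`.** -/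
theorem legP_cos_eq_sum (n : ℕ) (θ : ℝ) :
    legP n (Real.cos θ) = ∑ k ∈ range (n + 1), binomHalf k * binomHalf (n - k) * Real.cos (((2 * (k : ℤ) - n : ℤ) : ℝ) * θ) := by
  rw [legP_eq_sum_chebyshev]
  refine Finset.sum_congr rfl fun k _ => ?_
  rw [Chebyshev.T_real_cos]

/-- **`|P_n(cos θ)| ≤ 1`**: a cosine polynomial with non-negative coefficients of total mass `1`. -/
theorem abs_legP_cos_le_one (n : ℕ) (θ : ℝ) : |legP n (Real.cos θ)| ≤ 1 := by
  rw [legP_cos_eq_sum]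
  calc |∑ k ∈ range (n + 1), binomHalf k * binomHalf (n - k) * Real.cos (((2 * (k : ℤ) - n : ℤ) : ℝ) * θ)|
      ≤ ∑ k ∈ range (n + 1), |binomHalf k * binomHalf (n - k) * Real.cos (((2 * (k : ℤ) - n : ℤ) : ℝ) * θ)| :=
        Finset.abs_sum_le_sum_abs _ _
    _ ≤ ∑ k ∈ range (n + 1), binomHalf k * binomHalf (n - k) := by
        refine Finset.sum_le_sum fun k _ => ?_
        have hb : 0 ≤ binomHalf k * binomHalf (n - k) := by
          have := binomHalf_pos k; have := binomHalf_pos (n - k); positivity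
        rw [abs_mul, abs_of_nonneg hb]
        exact mul_le_of_le_one_right hb (Real.abs_cos_le_one _)
    _ = 1 := sum_range_binomHalf n

/-- **`|P_n(x)| ≤ 1` on `[−1, 1]`**, second proof (`x = cos (arccos x)`). -/
theorem abs_legP_le_one' (n : ℕ) {x : ℝ} (hx : x ∈ Icc (-1 : ℝ) 1) : |legP n x| ≤ 1 := by
  rw [← Real.cos_arccos hx.1 hx.2]
  exact abs_legP_cos_le_one n _

/-- The `k = n` and `k = 0` terms carry `a_n` each: the Chebyshev expansion of `P_n` has leading Chebyshev coefficient
`2 a_n = 2 C(2n,n)/4ⁿ` on `T_n` (`T_{−n} = T_n`). -/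
theorem chebSum_coeff_ends (n : ℕ) : binomHalf n * binomHalf (n - n) = binomHalf n ∧ binomHalf 0 * binomHalf (n - 0) = binomHalf n := by
  simp

end Summit.Ventures.HodgeRepro2.T5SU11LegendreChebyshev
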